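import Literature.NumberTheory.EllipticCurves.DivisionValuesSigmaFormulaProofs
import HarnessLib

/-!
# The canonical `p`-adic height takes values in `pℤ_p` on `E(ℚ) ∩ E₁(ℚ_p)` (integral model, `p ≥ 3`);
# `p ∣ ψₙ(P) ⇒ nP ∈ E₁(ℚ_p)` (proofs only)

Topic `NumberTheory/EllipticCurves`; proofs-only companion of `CanonicalPAdicHeightIntegralityProofs`
(Mazur–Tate 1983 integrality, stated there for a GLOBALLY MINIMAL equation) and of
`DivisionValuesSigmaFormulaProofs`. No definition, no named fact.

* `norm_pairing_self_le_inv_of_one_lt_norm` — for ANY `ℤ`-integral equation `W/ℚ`, an odd prime `p`, THE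
  canonical datum `D` (`PAdicHeightData.IsCanonical`) and a rational point `Q = (x, y)` with `‖x‖_p > 1`
  reducing non-singularly at every prime: **`‖⟨Q, Q⟩_D‖ ≤ p⁻¹`** (`⟨Q,Q⟩ = ĥ_p(Q) = log_p num x + O(z)`,
  `‖log_p‖ ≤ p⁻¹`, `‖z‖ ≤ p⁻¹`; Mazur–Tate's value `ρ_p(𝔬_p^*) ⊆ pℤ_p`). Same proof as the tree's
  `norm_pairing_self_le_of_isAdmissible`, with `[IsGloballyMinimal]` weakened to `[IsIntegral ℤ]`.
* `norm_pairing_self_le_inv_of_mem_kernelOfReductionAt` — on an integral model over `ℤ` whose discriminant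
  is divisible by the square of no prime (so that EVERY rational point reduces non-singularly everywhere),
  `‖⟨Q, Q⟩_D‖ ≤ p⁻¹` for every `Q ∈ E(ℚ) ∩ E₁(ℚ_p)` (`WeierstrassCurve.kernelOfReductionAt`).
* `zsmul_some_mem_kernelOfReductionAt_of_dvd_ψ` — `p ∣ ψₙ(P)` ⇒ `n • P ∈ E₁(ℚ_p)` for an integral point `P`
  with non-singular reduction at `p` (the `p`-part of the exact denominator; `n • P = O` if `ψₙ(P) = 0`).

Used by the valuation-class line of crux `SchneiderOnDoorSubfamily` (BSD, rank 2) for the cross term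
`⟨2P₁ + 3P₂, 2P₁ + 3P₂⟩ ∈ 3ℤ₃` of the digit certificate.

## References
* [MazurTate1983Biext] B. Mazur, J. Tate, *Canonical height pairings via biextensions* (1983), §3.3 and
  (4.1.1)–(4.4) (the canonical height is `pℤ_p`-valued on the good-reduction/formal-group locus).
* [MazurSteinTate2006] B. Mazur, W. Stein, J. Tate, Doc. Math. Extra Vol. (2006), §1 eq. (1.1).
* [Stange2016] K. E. Stange, Canad. J. Math. 68 (2016), §5 proof of Thm. 12 (`v(Θ([n]P)) = v(Ψₙ(P))`).
-/

noncomputable section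

open scoped Classical
open Literature.NumberTheory.EllipticCurves

namespace WeierstrassCurve

section Rat

variable (W : WeierstrassCurve ℚ) [W.IsIntegral ℤ] (p : ℕ) [Fact p.Prime]

/-- **`⟨Q, Q⟩_D ∈ pℤ_p` for a point of `E₁(ℚ_p)` reducing non-singularly everywhere** (`ℤ`-integral
equation, `p ≥ 3`, `D` THE canonical datum): `‖⟨Q, Q⟩_D‖ ≤ p⁻¹`. The tree's
`norm_pairing_self_le_of_isAdmissible` with `[IsGloballyMinimal]` weakened to `[IsIntegral ℤ]` (same proof:
`‖ĥ_p(Q) − log_p num x‖ ≤ ‖z(Q)‖ ≤ p⁻¹` and `‖log_p‖ ≤ p⁻¹`).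
[cite: MazurTate1983Biext, §3.3 (display after (3.3.4)) and (4.4) Prop.] -/
theorem norm_pairing_self_le_inv_of_one_lt_norm (hp3 : 3 ≤ p) {D : PAdicHeightData W p}
    (hD : D.IsCanonical) {x y : ℚ} (h : W.toAffine.Nonsingular x y) (hx : 1 < ‖(x : ℚ_[p])‖)
    (hred : ∀ ℓ : ℕ, ℓ.Prime → W.HasNonsingularReductionAt ℓ x y) :
    ‖D.pairing (.some x y h) (.some x y h)‖ ≤ (p : ℝ)⁻¹ := by
  have hp2 : p ≠ 2 := by omega
  have hadm : W.IsAdmissible p (.some x y h) := W.isAdmissible_of_one_lt_norm hp3 h hx hred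
  have hsub := PAdicHeightData.IsCanonical.norm_pairing_self_sub_padicLog_num_le W p hD hp2 hadm
  have hz : ‖(x : ℚ_[p]) / y‖ ≤ (p : ℝ)⁻¹ := by
    refine norm_le_inv_of_norm_lt_one ?_
    have h2 := norm_div_sq_eq_inv_norm_of_one_lt_norm (p := p) h hx
    have hlt : ‖(x : ℚ_[p]) / y‖ ^ 2 < 1 := by rw [h2]; exact inv_lt_one_of_one_lt₀ hx
    exact (pow_lt_one_iff_of_nonneg (norm_nonneg _) two_ne_zero).mp hlt
  calc ‖D.pairing (.some x y h) (.some x y h)‖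
      = ‖(D.pairing (.some x y h) (.some x y h) - padicLog p (x.num : ℚ_[p])) +
          padicLog p (x.num : ℚ_[p])‖ := by rw [sub_add_cancel]
    _ ≤ max ‖D.pairing (.some x y h) (.some x y h) - padicLog p (x.num : ℚ_[p])‖
          ‖padicLog p (x.num : ℚ_[p])‖ := IsUltrametricDist.norm_add_le_max _ _
    _ ≤ (p : ℝ)⁻¹ := max_le (hsub.trans hz) (norm_padicLog_le_inv hp2 _)

end Rat

section Int

variable (V : WeierstrassCurve ℤ) {a b : ℤ} (p : ℕ) [Fact p.Prime]

/-- **`p ∣ ψₙ(P) ⇒ n • P ∈ E₁(ℚ_p)`** for an integral point `P = (a, b)` of `V ⊗ ℚ` with non-singular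
reduction at `p` (if `ψₙ(P) = 0` then `n • P = O`; otherwise `‖x(nP)‖_p = ‖ψₙ(P)‖_p⁻² > 1`).
[cite: Stange2016, §5 proof of Thm 12] -/
theorem zsmul_some_mem_kernelOfReductionAt_of_dvd_ψ
    (h : (V.map (Int.castRingHom ℚ)).toAffine.Nonsingular (a : ℚ) (b : ℚ))
    (hred : (V.map (Int.castRingHom ℚ)).HasNonsingularReductionAt p a b) {n : ℤ}
    (hp : (p : ℤ) ∣ (V.ψ n).evalEval a b) :
    haveI : (V.map (Int.castRingHom ℚ)).IsIntegral ℤ := ⟨V, rfl⟩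
    n • Affine.Point.some _ _ h ∈ (V.map (Int.castRingHom ℚ)).kernelOfReductionAt p := by
  haveI : (V.map (Int.castRingHom ℚ)).IsIntegral ℤ := ⟨V, rfl⟩
  by_cases hψ : (V.ψ n).evalEval a b = 0
  · rw [(Affine.Point.zsmul_some_intCast_eq_zero_iff V h n).mpr hψ]
    exact AddSubgroup.zero_mem _
  · obtain ⟨h₁, e⟩ := Affine.Point.zsmul_some_intCast_eq V h hψ
    rw [e]
    exact (some_mem_kernelOfReductionAt_iff h₁).mpr (V.norm_x_zsmul_eq p h hred hψ hp).2

/-- **`‖⟨Q, Q⟩_D‖ ≤ p⁻¹` on `E(ℚ) ∩ E₁(ℚ_p)`** for an integral model over `ℤ` whose discriminant is divisible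
by the square of no prime (every rational point reduces non-singularly everywhere), `p ≥ 3`, `D` canonical.
[cite: MazurTate1983Biext, §3.3 (display after (3.3.4)) and (4.4) Prop.] -/
theorem norm_pairing_self_le_inv_of_mem_kernelOfReductionAt (hp3 : 3 ≤ p)
    (hΔ : ∀ ℓ : ℕ, ℓ.Prime → ¬ (ℓ : ℤ) ^ 2 ∣ V.Δ)
    {D : PAdicHeightData (V.map (Int.castRingHom ℚ)) p} (hD : D.IsCanonical)
    (Q : (V.map (Int.castRingHom ℚ)).toAffine.Point)
    (hQ : haveI : (V.map (Int.castRingHom ℚ)).IsIntegral ℤ := ⟨V, rfl⟩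
      Q ∈ (V.map (Int.castRingHom ℚ)).kernelOfReductionAt p) :
    ‖D.pairing Q Q‖ ≤ (p : ℝ)⁻¹ := by
  haveI : (V.map (Int.castRingHom ℚ)).IsIntegral ℤ := ⟨V, rfl⟩
  rcases Q with _ | ⟨x, y, h⟩
  · rw [show (Affine.Point.zero : (V.map (Int.castRingHom ℚ)).toAffine.Point) = 0 from rfl, map_zero]
    simp
  · exact (V.map (Int.castRingHom ℚ)).norm_pairing_self_le_inv_of_one_lt_norm p hp3 hD h
      ((some_mem_kernelOfReductionAt_iff h).mp hQ)
      fun ℓ hℓ => by haveI := Fact.mk hℓ; exact V.hasNonsingularReductionAt_of_not_sq_dvd_Δ ℓ (hΔ ℓ hℓ) h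

end Int

end WeierstrassCurve

end
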